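import Literature.Geometry.Lorentzian.RecedingKerrInitialLayerNorm
import HarnessLib

/-!
# Lab-time covariance of the receding multi-Kerr initial layer

The hyperboloidal `N`-hole layer `RecedingKerr.layer M a Λ ξ τ ℓ` of `RecedingKerrInitialLayerNorm`
(Klainerman–Szeftel arXiv:2104.11857 §3.1 template; route-posited for `N ≥ 2`) depends on the lab
time `τ` only through a TIME TRANSLATION of `E4`: the layer at lab time `τ + σ` is the translate by
`σ ∂ₜ` of the layer at lab time `τ`, and the reference background (the superposed boosted
Kerr–Schild form with centres `(τ, ξᵢ)`) and the layer time are carried along. Consequently a chart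
`Φ` of the layer at lab time `τ` re-parametrises to a chart `Φ ∘ (· − σ ∂ₜ)` of the layer at lab
time `τ + σ` with the same image, the same leaves and the same deviation — the observation that in
hand-over clauses of the form "`∀ τ₁, ∃ τ ≥ τ₁`, a layer chart at lab time `τ` with …" (route
DerivativeThrift, items `ThriftyClusterSettling` / `ThriftyHandoff`) the lab time carries no
intrinsic content (the chart absorbs it). This file proves the set-level and background-level
covariance (pure algebra of `E4.ofTimeSpace`, `poincareInv`, `layerTime`); no definitions, no
named facts.

References: Klainerman–Szeftel arXiv:2104.11857, §3.1 (initial data layer); O'Neill 1983, Ch. 9,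
p. 236 (Poincaré maps); Hawking–Ellis 1973, §5.1 (time translations of Minkowski space).
-/

noncomputable section

open Set
open scoped Manifold

namespace Literature.Geometry.Lorentzian

namespace E4

/-- `(t + σ, y) = (t, y) + σ ∂ₜ` in `E4` (time-only case of `E4.ofTimeSpace_add`, `ModelData`,
stated with the translation vector `σ ∂ₜ`). Hawking–Ellis 1973, §5.1. [folklore] -/
theorem ofTimeSpace_add_time (t σ : ℝ) (y : E3) :
    ofTimeSpace (t + σ) y = ofTimeSpace t y + σ • basisVector 0 := by
  ext i
  refine Fin.cases ?_ (fun j ↦ ?_) i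
  · simp
  · simp [Fin.succ_ne_zero]

/-- Time translation does not change the spatial part: `(x + σ ∂ₜ)̲ = x̲`. Hawking–Ellis 1973,
§5.1. [folklore] -/
theorem spatial_add_smul_basisVector_zero (x : E4) (σ : ℝ) :
    spatial (x + σ • basisVector 0) = spatial x := by
  ext i
  simp [spatial_apply, Fin.succ_ne_zero]

/-- Time translation shifts the time coordinate: `(x + σ ∂ₜ)⁰ = x⁰ + σ`. Hawking–Ellis 1973, §5.1.
[folklore] -/
theorem apply_zero_add_smul_basisVector_zero (x : E4) (σ : ℝ) :
    (x + σ • basisVector 0) 0 = x 0 + σ := by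
  simp

/-- Time translation does not change the spatial radius. Hawking–Ellis 1973, §5.1. [folklore] -/
theorem spatialNorm_add_smul_basisVector_zero (x : E4) (σ : ℝ) :
    spatialNorm (x + σ • basisVector 0) = spatialNorm x := by
  rw [spatialNorm, spatialNorm, spatial_add_smul_basisVector_zero]

end E4

/-- **Rest-frame coordinates are lab-time covariant**: translating the centre and the point by the
same `σ ∂ₜ` leaves `Λ⁻¹(x − c)` unchanged. O'Neill 1983, Ch. 9, p. 236. [folklore] -/
theorem poincareInv_ofTimeSpace_add (Λ : lorentzGroup) (t σ : ℝ) (y : E3) (x : E4) :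
    poincareInv Λ (E4.ofTimeSpace (t + σ) y) (x + σ • E4.basisVector 0) =
      poincareInv Λ (E4.ofTimeSpace t y) x := by
  rw [poincareInv, poincareInv, E4.ofTimeSpace_add_time, add_sub_add_right_eq_sub]

/-- **The boosted Kerr–Schild form is lab-time covariant**: with the centre moved from `(t, y)` to
`(t + σ, y)`, its value at `x + σ ∂ₜ` is its old value at `x`. Kerr–Schild 1965 (Poincaré
covariance of the ansatz). [folklore] -/
theorem boostedKerrBilin_ofTimeSpace_add (Λ : lorentzGroup) (t σ : ℝ) (y : E3) (M a : ℝ) (x : E4) :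
    boostedKerrBilin Λ (E4.ofTimeSpace (t + σ) y) M a (x + σ • E4.basisVector 0) =
      boostedKerrBilin Λ (E4.ofTimeSpace t y) M a x := by
  ext v w
  rw [boostedKerrBilin_apply, boostedKerrBilin_apply, poincareInv_ofTimeSpace_add]

namespace RecedingKerr

variable {N : ℕ} (M a : Fin N → ℝ) (Λ : Fin N → lorentzGroup) (ξ : Fin N → E3) (τ σ ℓ : ℝ)

/-- **The layer time is lab-time covariant**: `s_{τ+σ}(x + σ ∂ₜ) = s_τ(x)`. Klainerman–Szeftel
arXiv:2104.11857, §3.1. [folklore] -/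
theorem layerTime_add (x : E4) :
    layerTime (τ + σ) ℓ (x + σ • E4.basisVector 0) = layerTime τ ℓ x := by
  unfold layerTime
  rw [E4.apply_zero_add_smul_basisVector_zero, E4.spatialNorm_add_smul_basisVector_zero]
  ring

/-- **The rest-frame hole radii are lab-time covariant.** [folklore] -/
theorem holeRadius_add (i : Fin N) (x : E4) :
    holeRadius a Λ ξ (τ + σ) i (x + σ • E4.basisVector 0) = holeRadius a Λ ξ τ i x := by
  unfold holeRadius
  rw [poincareInv_ofTimeSpace_add]

/-- **The layer is lab-time covariant**: `x + σ ∂ₜ ∈ 𝓛_{τ+σ} ↔ x ∈ 𝓛_τ`. Klainerman–Szeftel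
arXiv:2104.11857, §3.1. [folklore] -/
theorem add_mem_layer_iff {x : E4} :
    x + σ • E4.basisVector 0 ∈ layer M a Λ ξ (τ + σ) ℓ ↔ x ∈ layer M a Λ ξ τ ℓ := by
  simp only [mem_layer, layerTime_add, holeRadius_add]

/-- **The layer at lab time `τ + σ` is the time translate of the layer at lab time `τ`.**
Klainerman–Szeftel arXiv:2104.11857, §3.1. [folklore] -/
theorem image_layer_add :
    (fun x : E4 ↦ x + σ • E4.basisVector 0) '' (layer M a Λ ξ τ ℓ : Set E4) =
      (layer M a Λ ξ (τ + σ) ℓ : Set E4) := by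
  refine Set.ext fun x ↦ ⟨?_, fun hx ↦ ?_⟩
  · rintro ⟨y, hy, rfl⟩
    exact (add_mem_layer_iff M a Λ ξ τ σ ℓ).2 hy
  · refine ⟨x - σ • E4.basisVector 0, ?_, sub_add_cancel _ _⟩
    have h : x - σ • E4.basisVector 0 + σ • E4.basisVector 0 ∈ layer M a Λ ξ (τ + σ) ℓ := by
      rw [sub_add_cancel]
      exact hx
    exact (add_mem_layer_iff M a Λ ξ τ σ ℓ).1 h

/-- **The reference background is lab-time covariant**: `G_{τ+σ}(x + σ ∂ₜ) = G_τ(x)` for the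
superposed boosted Kerr–Schild form. Kerr–Schild 1965. [folklore] -/
theorem background_bilin_add (x : E4) :
    (background M a Λ ξ (τ + σ) ℓ).bilin (x + σ • E4.basisVector 0) =
      (background M a Λ ξ τ ℓ).bilin x := by
  simp only [background, boostedKerrBilin_ofTimeSpace_add]

/-- **The near and far parts of the layer are lab-time covariant** (the split is by `|x̲|`, which
time translation preserves). Klainerman–Szeftel arXiv:2104.11857, §3.1. [folklore] -/
theorem add_mem_nearLayer_iff {x : E4} :
    x + σ • E4.basisVector 0 ∈ nearLayer M a Λ ξ (τ + σ) ℓ ↔ x ∈ nearLayer M a Λ ξ τ ℓ := by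
  simp only [nearLayer, Set.mem_setOf_eq, E4.spatialNorm_add_smul_basisVector_zero]
  exact and_congr_left fun _ ↦ add_mem_layer_iff M a Λ ξ τ σ ℓ

/-- The far part likewise. [folklore] -/
theorem add_mem_farLayer_iff {x : E4} :
    x + σ • E4.basisVector 0 ∈ farLayer M a Λ ξ (τ + σ) ℓ ↔ x ∈ farLayer M a Λ ξ τ ℓ := by
  simp only [farLayer, Set.mem_setOf_eq, E4.spatialNorm_add_smul_basisVector_zero]
  exact and_congr_left fun _ ↦ add_mem_layer_iff M a Λ ξ τ σ ℓ

end RecedingKerr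

end Literature.Geometry.Lorentzian

end
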